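import Summits.ResolutionOfSingularities.ResolutionOfSingularities.Theorems.EquisingularLiftEquisingularLiftNatStrictTransformComap
import Summits.ResolutionOfSingularities.ResolutionOfSingularities.Theorems.EquisingularLiftEquisingularLiftNatStrictTransformVanishingIdeal
import Summits.ResolutionOfSingularities.ResolutionOfSingularities.Theorems.EquisingularLiftEquisingularLiftNatStrictTransformClosureCompl
import Literature.AlgebraicGeometry.Resolution.KollarEtaleNeighbourhood
import Literature.AlgebraicGeometry.Resolution.BlowupSNC
import HarnessLib

/-!
# [OURS · L1 W4.5(b) · EL♮(3)] S7 (vii-loc) — THE LOCALIZED SHADOW TRACE of the Member's cone near the exceptional surface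
# (crux `EquisingularLiftNatThree` = stmt-ResolutionOfSingularities-20148, parent EL♮ stmt-…-20038; line `sections`)

res-type-100 g12, object S7 `hBaseKCL` of res-D-pv-029's TOWER₃ assembly (res-L1-w45b-plan-1 CHAIN v7.31 §1(1); res-D-pv-029 DECISION
2026-08-27T20:53:20Z = repair (R1): clause (vii)/(k-ii) of `TCPlus.MemberKC` / `Tower.Shadow₂` LOCALIZED to an open neighbourhood of the
carrier curve — `TCPlus.MemberKCL` (…NatSubchainSupplierInvKDefs v3, p570160) clause (vii-loc)
`∃ V : G.Opens, Z ⊆ V ∧ (K.comap jG).comap V.ι = 𝓘⟨closure K_d⟩.comap V.ι`). OURS; NOT a statement of any manuscript; AI-written, weaker than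
expert review; `--supports stmt-ResolutionOfSingularities-20148 --as helper`; closes nothing by itself. Definition-free.

WHY LOCAL (my FINDING 2026-08-27T20:46:11Z, accepted): the Member's cone `K₀` upstairs is a prescribed-GERM Cartier divisor of the regular
4-fold `X'` (`K₀_{j x} = (Φ(c))`); its other components may re-enter the special fibre `F₁` far from `x`, so the global trace
`(St_{τ₁} K₀)·𝒪_{F₂} = 𝓘⟨St_x W⟩` is false in general; near `υ⁻¹{x}` it holds as soon as the GERMS agree downstairs:
`(K₀·𝒪_{F₁})_x = 𝓘⟨closure W⟩_x` (the cone-form exactness, supplied by the KCL twins of the bricks from `ConeForm F₁ x W`).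

THE STATEMENTS.
* `comap_ι_strictTransformIdeal_eq_of_forall_stalkIdeal_eq` — strict transforms are computed stalkwise from the stalk downstairs
  (Literature `stalkIdeal_strictTransformIdeal`): if two ideal sheaves `I, J` on `F₁` have the same stalks along an open `O`, then
  `St_υ I` and `St_υ J` agree on `υ⁻¹O` (any morphism `υ`, any centre `C`).
* `exists_nhd_comap_ι_strictTransformIdeal_eq` — if `I_x = J_x` then `St_υ I = St_υ J` on `υ⁻¹O` for an open `O ∋ x`
  (Literature `exists_nhd_forall_stalkIdeal_eq`: stalk equalities of coherent ideal sheaves spread, `F₁` locally Noetherian).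
* `exists_nhd_comap_strictTransformIdeal_eq_vanishingIdeal_of_model` — **(vii-loc) SUPPLIER.** In the model square of res-L1-w45b-stub-1's
  F⁺5 `comap_strictTransformIdeal_eq_of_model` (…NatStrictTransformComap: `(St_τ K)·𝒪_{F₂} = St_υ (K·𝒪_{F₁})` for an equimultiple cone
  pack at `j x`), if moreover `(K·𝒪_{F₁})_x = 𝓘⟨closure W⟩_x`, then there is an open `V ⊇ υ⁻¹{x}` of `F₂` with
  `((St_τ K)·𝒪_{F₂})|_V = 𝓘⟨closure υ⁻¹(W ∖ {x})⟩|_V` (res-L1-w45b-stub-4's `strictTransformIdeal_vanishingIdeal_eq`: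
  `St_υ 𝓘⟨closure W⟩ = 𝓘⟨closure υ⁻¹(closure W ∖ {x})⟩ = 𝓘⟨St_x W⟩`, …NatStrictTransformClosureCompl).
* `exists_nhd_comap_strictTransformIdeal_eq_shadow_of_model` — the same in the LETTER of `TCPlus.MemberKCL` (vii-loc) at the base stage:
  `∃ V, υ⁻¹{x} ∩ closure υ⁻¹(W ∖ {x}) ⊆ V ∧ ((St_τ K).comap j₂).comap V.ι = 𝓘⟨closure (closure υ⁻¹(W ∖ {x}))⟩.comap V.ι`.

References: U. Görtz, T. Wedhorn, *Algebraic Geometry I* (2nd ed. 2020), Prop. 13.91, (13.19), Prop. 13.96; The Stacks Project, Tag 0804,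
Tag 080E, Tag 01J7; J. Kollár, *Lectures on Resolution of Singularities* (2007), §3 (spreading of stalk identities) — through the cited tree files.
-/

set_option linter.dupNamespace false -- mandated namespace `Summit.<Summit>.<Problem>` of this single-conjunct summit

noncomputable section

open CategoryTheory AlgebraicGeometry TopologicalSpace Topology
open Literature.AlgebraicGeometry.Resolution AlgebraicGeometry.Scheme.IdealSheafData

namespace Summit.ResolutionOfSingularities.ResolutionOfSingularities.Cruxes.EquisingularLiftNat.Sections

/-! ## Strict transforms of stalkwise-equal ideal sheaves -/

section Generic

variable {F₁ F₂ : Scheme.{0}} [IsLocallyNoetherian F₂] (υ : F₂ ⟶ F₁) (C : F₁.IdealSheafData)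

/-- Two ideal sheaves with the same stalks along an open `O` have strict transforms (under any morphism `υ`, along any centre `C`)
which agree on `υ⁻¹O`: the stalk of a strict transform at `w` only depends on the stalk downstairs at `υ w`
(Literature `stalkIdeal_strictTransformIdeal`). [cite: GortzWedhorn2020, (13.19) p. 414] [folklore] -/
theorem comap_ι_strictTransformIdeal_eq_of_forall_stalkIdeal_eq (I J : F₁.IdealSheafData) (O : F₁.Opens)
    (hO : ∀ y ∈ O, stalkIdeal I y = stalkIdeal J y) :
    (strictTransformIdeal υ C I).comap (υ ⁻¹ᵁ O).ι = (strictTransformIdeal υ C J).comap (υ ⁻¹ᵁ O).ι := by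
  refine comap_ι_eq_of_forall_stalkIdeal_eq (υ ⁻¹ᵁ O) fun w hw => ?_
  rw [stalkIdeal_strictTransformIdeal, stalkIdeal_strictTransformIdeal, hO (υ w) hw]

variable [IsLocallyNoetherian F₁]

/-- If two ideal sheaves on the locally Noetherian `F₁` have the same stalk at `x`, their strict transforms agree on `υ⁻¹O` for some
open `O ∋ x` (stalk identities of coherent ideal sheaves spread to a neighbourhood, Literature `exists_nhd_forall_stalkIdeal_eq`).
[cite: StacksProject, Tag 01J7] [folklore] -/
theorem exists_nhd_comap_ι_strictTransformIdeal_eq (I J : F₁.IdealSheafData) {x : F₁} (h : stalkIdeal I x = stalkIdeal J x) :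
    ∃ O : F₁.Opens, x ∈ O ∧
      (strictTransformIdeal υ C I).comap (υ ⁻¹ᵁ O).ι = (strictTransformIdeal υ C J).comap (υ ⁻¹ᵁ O).ι := by
  obtain ⟨O, hxO, hO⟩ := exists_nhd_forall_stalkIdeal_eq h
  exact ⟨O, hxO, comap_ι_strictTransformIdeal_eq_of_forall_stalkIdeal_eq υ C I J O hO⟩

end Generic

/-! ## (vii-loc) in the model square -/

section Model

/-- **(vii-loc) SUPPLIER: the Member's cone has special fibre the strict transform `St_x W` NEAR `υ⁻¹{x}`.** In the model-square setting
of F⁺5 `comap_strictTransformIdeal_eq_of_model` (an equimultiple cone pack `(c, Φ)` for `K` at `j x`), if the special-fibre germ of the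
cone is the germ of `closure W` — `(K·𝒪_{F₁})_x = 𝓘⟨closure W⟩_x` — then on some open `V ⊇ υ⁻¹{x}` of `F₂` the special fibre of the
strict transform `St_τ K` is the reduced strict transform `𝓘⟨closure υ⁻¹(W ∖ {x})⟩`. [cite: GortzWedhorn2020, Prop. 13.96 (2) and (13.19)]
[cite: StacksProject, Tag 0804] [OURS · L1 W4.5b] S7 toward `hBaseKCL`; NOT a statement of the manuscript. -/
theorem exists_nhd_comap_strictTransformIdeal_eq_vanishingIdeal_of_model {X' X₁ F₁ F₂ : Scheme.{0}} (τ : X₁ ⟶ X')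
    (J K : X'.IdealSheafData) (hτ : IsBlowup τ J) [IsLocallyNoetherian X₁] [IsLocallyNoetherian F₂]
    [IsIntegral F₁] [IsIntegral F₂] [IsLocallyNoetherian F₁]
    (j : F₁ ⟶ X') (υ : F₂ ⟶ F₁) (j₂ : F₂ ⟶ X₁) (hcomm : j₂ ≫ τ = υ ≫ j)
    (x : F₁) (hx : IsClosed ({x} : Set F₁))
    (hυ : IsBlowup υ (vanishingIdeal ⟨{x}, hx⟩)) (hJ : J.comap j = vanishingIdeal ⟨{x}, hx⟩)
    {r : ℕ} (c : Fin r → X'.presheaf.stalk (j x)) (hcJ : Ideal.span (Set.range c) = stalkIdeal J (j x))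
    (hc : IsQuasiRegular c) [IsDomain (X'.presheaf.stalk (j x) ⧸ Ideal.span (Set.range c))]
    {d : ℕ} (Φ : MvPolynomial (Fin r) (X'.presheaf.stalk (j x))) (hΦd : Φ.IsHomogeneous d)
    (hΦ : MvPolynomial.map (Ideal.Quotient.mk (Ideal.span (Set.range c))) Φ ≠ 0)
    (hK : stalkIdeal K (j x) = Ideal.span {MvPolynomial.eval c Φ})
    (hcbar : IsQuasiRegular (fun i => (j.stalkMap x).hom (c i)))
    (hΦbar : MvPolynomial.map (Ideal.Quotient.mk (Ideal.span (Set.range fun i => (j.stalkMap x).hom (c i))))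
      (MvPolynomial.map (j.stalkMap x).hom Φ) ≠ 0)
    (W : Set F₁) (hKW : stalkIdeal (K.comap j) x = stalkIdeal (vanishingIdeal (⟨closure W, isClosed_closure⟩ : Closeds F₁)) x) :
    ∃ V : F₂.Opens, (υ ⁻¹' {x} : Set F₂) ⊆ (V : Set F₂) ∧
      ((strictTransformIdeal τ J K).comap j₂).comap V.ι =
        (vanishingIdeal (⟨closure (υ ⁻¹' (W \ {x})), isClosed_closure⟩ : Closeds F₂)).comap V.ι := by
  obtain ⟨O, hxO, hO⟩ := exists_nhd_comap_ι_strictTransformIdeal_eq υ (vanishingIdeal ⟨{x}, hx⟩) (K.comap j)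
    (vanishingIdeal (⟨closure W, isClosed_closure⟩ : Closeds F₁)) hKW
  refine ⟨υ ⁻¹ᵁ O, fun w hw => ?_, ?_⟩
  · change υ w ∈ O
    rw [show υ w = x from hw]
    exact hxO
  · have hcl : (⟨closure (υ ⁻¹' (closure W \ ((vanishingIdeal (⟨{x}, hx⟩ : Closeds F₁)).support : Set F₁))), isClosed_closure⟩ :
        Closeds F₂) = ⟨closure (υ ⁻¹' (W \ {x})), isClosed_closure⟩ :=
      Closeds.ext (by
        change closure (υ ⁻¹' (closure W \ ((vanishingIdeal (⟨{x}, hx⟩ : Closeds F₁)).support : Set F₁))) =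
          closure (υ ⁻¹' (W \ {x}))
        rw [Scheme.IdealSheafData.coe_support_vanishingIdeal, Closeds.coe_mk, closure_preimage_diff_singleton_eq_of_isBlowup hx hυ W])
    rw [comap_strictTransformIdeal_eq_of_model τ J K hτ j υ j₂ hcomm x hx hυ hJ c hcJ hc Φ hΦd hΦ hK hcbar hΦbar, hO,
      strictTransformIdeal_vanishingIdeal_eq υ (vanishingIdeal ⟨{x}, hx⟩) hυ (closure W) isClosed_closure, hcl]

/-- **(vii-loc) in the letter of `TCPlus.MemberKCL` at the base stage** (`Z := υ⁻¹{x} ∩ closure υ⁻¹(W ∖ {x})`,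
`K_d := closure υ⁻¹(W ∖ {x})`): under the hypotheses of `exists_nhd_comap_strictTransformIdeal_eq_vanishingIdeal_of_model`,
`∃ V, Z ⊆ V ∧ ((St_τ K).comap j₂).comap V.ι = 𝓘⟨closure K_d⟩.comap V.ι`. [OURS · L1 W4.5b] S7; NOT a statement of the manuscript. -/
theorem exists_nhd_comap_strictTransformIdeal_eq_shadow_of_model {X' X₁ F₁ F₂ : Scheme.{0}} (τ : X₁ ⟶ X')
    (J K : X'.IdealSheafData) (hτ : IsBlowup τ J) [IsLocallyNoetherian X₁] [IsLocallyNoetherian F₂]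
    [IsIntegral F₁] [IsIntegral F₂] [IsLocallyNoetherian F₁]
    (j : F₁ ⟶ X') (υ : F₂ ⟶ F₁) (j₂ : F₂ ⟶ X₁) (hcomm : j₂ ≫ τ = υ ≫ j)
    (x : F₁) (hx : IsClosed ({x} : Set F₁))
    (hυ : IsBlowup υ (vanishingIdeal ⟨{x}, hx⟩)) (hJ : J.comap j = vanishingIdeal ⟨{x}, hx⟩)
    {r : ℕ} (c : Fin r → X'.presheaf.stalk (j x)) (hcJ : Ideal.span (Set.range c) = stalkIdeal J (j x))
    (hc : IsQuasiRegular c) [IsDomain (X'.presheaf.stalk (j x) ⧸ Ideal.span (Set.range c))]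
    {d : ℕ} (Φ : MvPolynomial (Fin r) (X'.presheaf.stalk (j x))) (hΦd : Φ.IsHomogeneous d)
    (hΦ : MvPolynomial.map (Ideal.Quotient.mk (Ideal.span (Set.range c))) Φ ≠ 0)
    (hK : stalkIdeal K (j x) = Ideal.span {MvPolynomial.eval c Φ})
    (hcbar : IsQuasiRegular (fun i => (j.stalkMap x).hom (c i)))
    (hΦbar : MvPolynomial.map (Ideal.Quotient.mk (Ideal.span (Set.range fun i => (j.stalkMap x).hom (c i))))
      (MvPolynomial.map (j.stalkMap x).hom Φ) ≠ 0)
    (W : Set F₁) (hKW : stalkIdeal (K.comap j) x = stalkIdeal (vanishingIdeal (⟨closure W, isClosed_closure⟩ : Closeds F₁)) x) :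
    ∃ V : F₂.Opens, (υ ⁻¹' {x} ∩ closure (υ ⁻¹' (W \ {x})) : Set F₂) ⊆ (V : Set F₂) ∧
      ((strictTransformIdeal τ J K).comap j₂).comap V.ι =
        (vanishingIdeal (⟨closure (closure (υ ⁻¹' (W \ {x}))), isClosed_closure⟩ : Closeds F₂)).comap V.ι := by
  obtain ⟨V, hxV, hV⟩ := exists_nhd_comap_strictTransformIdeal_eq_vanishingIdeal_of_model τ J K hτ j υ j₂ hcomm x hx hυ hJ c
    hcJ hc Φ hΦd hΦ hK hcbar hΦbar W hKW
  have hcl : (⟨closure (closure (υ ⁻¹' (W \ {x}))), isClosed_closure⟩ : Closeds F₂) =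
      ⟨closure (υ ⁻¹' (W \ {x})), isClosed_closure⟩ := Closeds.ext closure_closure
  exact ⟨V, Set.inter_subset_left.trans hxV, by rw [hcl]; exact hV⟩

end Model

end Summit.ResolutionOfSingularities.ResolutionOfSingularities.Cruxes.EquisingularLiftNat.Sections

end
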